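import Summits.QuantumFields.YangMills.Theorems.ForcedResponseSkewnessFemtoEngineFinePin
import Summits.QuantumFields.YangMills.Theorems.ForcedResponseSkewnessFemtoEngineFineCertificate
import HarnessLib

/-!
# Route `ForcedResponseSkewness`: the route certificate from TWO PHYSICS LAWS IN ONE UNIT (lead `ym-line-frs-p1` g7, 2026-08-28)

Helper file (`--supports stmt-QuantumFields-26871`, also serves 24275).  Compositions of `FemtoEngine.femtoEngineSigR_of_hc`
(`…FemtoEngineFinePin.lean`) with the landed certificate `FemtoEngine.nt_of_femtoEngine` (g6): for every compact simple `G` and lattice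
representation `r`, ONE unit map `u → 0⁺` carrying
  (UV)  the three femto engine laws `FemtoEngineAt G r u` — E0′ `FBL6Osc`, E-sym `CentredOscLaw`, E-log `CentredFemtoLog` (centred femto cubes
        along `u`, the centre, arbitrary exteriors; Bałaban-class small-field renormalisation group with prescribed exterior, not in print), and
  (IR-light)  `HyperscalingClustering G r u` — `d⁸·|torusCov|` tends to `0` beyond the femto range, uniformly in `β` large and large tori,
implies both cruxes of the route and, with the declared residual `FloorWithScalingLimits` (24873), the leaf `NT`.

* `responseLocalisation_of_femtoEngineHC`, `runningCouplingCeiling_of_femtoEngineHC`,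
  **`nt_of_femtoEngineHC : FemtoEngineHCSigR → FloorWithScalingLimits → BalabanLadder.NT`**.

HONEST LABEL: kernel-checked compositions on a conditional rung line (leaf R2a `BalabanLadder.NT`, not the summit Statement); the audit classifies
them `proof.conditional` and they credit nothing: the engine laws, `HyperscalingClustering`, the residual, the cruxes, `NT` and the Yang–Mills mass
gap are NOT proved.
-/

set_option autoImplicit false

noncomputable section

namespace Summit.QuantumFields.YangMills.Cruxes.ResponseLocalisation.FemtoEngine

open Summit.QuantumFields.YangMills.Cruxes.ResponseLocalisation.Birth
open Summit.QuantumFields.YangMills.Theses.ForcedResponseSkewness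

/-- **Deciding crux from two physics laws in one unit**: `FemtoEngineHCSigR → ResponseLocalisation`. [folklore] -/
theorem responseLocalisation_of_femtoEngineHC (hH : FemtoEngineHCSigR) : ResponseLocalisation :=
  responseLocalisation_of_femtoEngine (femtoEngineSigR_of_hc hH)

/-- **Crux 24275 from two physics laws in one unit**: `FemtoEngineHCSigR → RunningCouplingCeiling`. [folklore] -/
theorem runningCouplingCeiling_of_femtoEngineHC (hH : FemtoEngineHCSigR) : RunningCouplingCeiling :=
  runningCouplingCeiling_of_femtoEngine (femtoEngineSigR_of_hc hH)

/-- **The route certificate from two physics laws in one unit**: the femto engine laws and hyperscaling-weighted clustering in ONE unit per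
`(G, r)`, plus the declared residual, give the leaf `NT` (through `Assembly`/`closes`).  Conditional; nothing of the hypotheses is proved. [folklore] -/
theorem nt_of_femtoEngineHC (hH : FemtoEngineHCSigR) (hRes : FloorWithScalingLimits) :
    Summit.QuantumFields.YangMills.Theses.BalabanLadder.NT :=
  nt_of_femtoEngine (femtoEngineSigR_of_hc hH) hRes

end Summit.QuantumFields.YangMills.Cruxes.ResponseLocalisation.FemtoEngine

end
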